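import Literature.NumberTheory.DiophantineGeometry.SmoothProperModelIsoOfGroupChunk
import Literature.NumberTheory.DiophantineGeometry.IntegralModelGroupTransport
import Literature.AlgebraicGeometry.GroupSchemes.StrictOpenKeepsGenericFibre
import Literature.AlgebraicGeometry.GroupSchemes.StrictOpenChunkInstances
import Literature.AlgebraicGeometry.GroupSchemes.BirationalGroupLawFromShears
import Literature.AlgebraicGeometry.GroupSchemes.LawAssocOfGenericFibre
import Literature.AlgebraicGeometry.GroupSchemes.GenericFibreGroupIso
import Literature.AlgebraicGeometry.Smoothening.SmoothSectionsDense
import Mathlib.RingTheory.Henselian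
import Mathlib.FieldTheory.IsAlgClosed.Basic
import HarnessLib

/-!
# Koizumi over a strictly local base, modulo the two road-W heads (W0 core, W1 Weil chunk)
# — [Koizumi1960, p. 377] [BLRNeronModels1990, §1.2 Prop. 8, §4.3–4.4, §5.1 Thm. 5] [Artin1986NeronModels, (1.12)]

Topic `Literature/NumberTheory/DiophantineGeometry`; THEOREMS ONLY; net Literature debt 0.  Cell `hodgecm-mathlib` (D-0151), road W
(r₀ as a theorem, banked Néron capital), sub-line `koizumi_strictly_local` of `Cruxes/H21/Lines/r0_koizumi.lean` (B-plan1): the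
COMPOSITION banked in the tree (B-plan1 13:54:44Z), D-0014-shaped — the not-yet-proved inputs are explicit `Prop` binders whose
texts are frozen: `hW0` = B-p18 `W0Statement` :32–:58 (the ω-argument's output), `hW1` = A-p06 probe-v6 (`koizumiStrictlyLocal_of_v6`,
TEXT OF RECORD) resp. probe-v4 (`koizumiStrictlyLocal_of`, stronger binder, kept)
`WeilGroupChunkStrictlyLocal` (Weil's group chunk over a strictly local base, `HasDenseSections` unfolded).  Discharged BY NAME:
A1 ★ `exists_birationalGroupLaw_of_shears` (B-p13), A2 ★ `LawData.assoc_of_genericFibre` (B-p21), GAP-B ★ `strictOpenKeepsGenericFibre` (A-p06), GAP-C/D ★ `strictOpenInstances` /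
`chunkGroupIntegral` (B-p13), W1e ★ `exists_section_apply_mem_fibre` (B-p07), W1d/(W23)/GAP-F ★ (A-p14:
`exists_iso_of_isOpenImmersion_of_isIrreducible_specialFibre`, `genericFibreIsGroupIso`), (W6t-a) ★
`IntegralModel.exists_grpObj_isMonHom_genericIso_of_iso` (B-p12).  Conclusion = `KoizumiStrictlyLocal` of `r0_koizumi.lean` v3
:62–:80, unfolded: the smooth proper model of an abelian variety over a complete dvr with algebraically closed residue field is a
group scheme whose own generic identification is a homomorphism.  Each head that lands drops one binder by a 3-line append.
HC_CM is proved only modulo the 7 printed citations until rung 0 closes.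
-/

noncomputable section

universe u

open CategoryTheory CategoryTheory.Limits AlgebraicGeometry MonoidalCategory CartesianMonoidalCategory MonObj GrpObj
open scoped CategoryTheory.Obj
open Literature Literature.AlgebraicGeometry.Motives Literature.NumberTheory.EllipticCurves
  Literature.AlgebraicGeometry.GroupSchemes Literature.AlgebraicGeometry.Smoothening

namespace Literature.NumberTheory.DiophantineGeometry

/-- **Koizumi's theorem over a complete strictly local dvr, modulo (W0) and (W1)** (road W of the `hodgecm-mathlib`
cell; [Koizumi1960] p. 377, [BLRNeronModels1990] 1.2/8 with 4.3–4.4 and 5.1/5, [Artin1986NeronModels] (1.12)): granted the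
ω-argument `hW0` (a generically-group-law `R`-birational law on the smooth proper model with open-immersion shears)
and Weil's group-chunk theorem `hW1` over strictly local bases, every smooth proper integral model
`𝒳′` (geometrically irreducible fibres) of an abelian variety `A′` over a complete dvr `R′` with algebraically closed residue
field carries a group-scheme structure for which its generic identification `𝒳′_{K′} ≅ A′` is a homomorphism.  Proof =
strictification keeping the generic fibre ★ → dense sections ★ → `hW1` → the model IS the group ★ (W23) → the generic fibre of
the group is `A′` as a group ★ (GAP-F) → transport ★ (W6t-a).
[cite: Koizumi1960, Thm. p. 377] [cite: BLRNeronModels1990, §1.2 Prop. 8] [cite: Artin1986NeronModels, Thm. (1.12)] -/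
theorem koizumiStrictlyLocal_of
    (hW0 : ∀ (R : Type u) [CommRing R] [IsDomain R] [IsDiscreteValuationRing R]
      (K : Type u) [Field K] [Algebra R K] [IsFractionRing R K]
      (𝒳 : Over (Spec (.of R))) [Smooth 𝒳.hom] [IsProper 𝒳.hom] [GeometricallyIrreducible 𝒳.hom]
      (E : Over (Spec (.of K))) [GrpObj E] (e : (genericFibre R K).obj 𝒳 ≅ E),
      ∃ (U : (𝒳 ⊗ 𝒳).left.Opens) (m : (U : Scheme.{u}) ⟶ 𝒳.left)
        (hm : m ≫ 𝒳.hom = U.ι ≫ (𝒳 ⊗ 𝒳).hom),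
        (𝒳 ⊗ 𝒳).hom.base ⁻¹' Set.range (specGenericPoint R K).base ⊆ (U : Set (𝒳 ⊗ 𝒳).left) ∧
        (∃ u : (𝒳 ⊗ 𝒳).left, u ∈ U ∧ (𝒳 ⊗ 𝒳).hom.base u = IsLocalRing.closedPoint R) ∧
        (genericFibre R K).map (Over.homMk m hm : Over.mk (U.ι ≫ (𝒳 ⊗ 𝒳).hom) ⟶ 𝒳) ≫ e.hom =
          (genericFibre R K).map (Over.homMk U.ι rfl : Over.mk (U.ι ≫ (𝒳 ⊗ 𝒳).hom) ⟶ 𝒳 ⊗ 𝒳) ≫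
            Functor.OplaxMonoidal.δ (genericFibre R K) 𝒳 𝒳 ≫ (e.hom ⊗ₘ e.hom) ≫ μ[E] ∧
        (let Φ : Over.mk (U.ι ≫ (𝒳 ⊗ 𝒳).hom) ⟶ 𝒳 ⊗ 𝒳 :=
            lift (Over.homMk U.ι rfl ≫ fst 𝒳 𝒳) (Over.homMk m hm);
          IsOpenImmersion Φ.left ∧
            (𝒳 ⊗ 𝒳).hom.base ⁻¹' Set.range (specGenericPoint R K).base ⊆ Set.range Φ.left.base) ∧
        (let Ψ : Over.mk (U.ι ≫ (𝒳 ⊗ 𝒳).hom) ⟶ 𝒳 ⊗ 𝒳 :=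
            lift (Over.homMk m hm) (Over.homMk U.ι rfl ≫ snd 𝒳 𝒳);
          IsOpenImmersion Ψ.left ∧
            (𝒳 ⊗ 𝒳).hom.base ⁻¹' Set.range (specGenericPoint R K).base ⊆ Set.range Ψ.left.base))
    (hW1 : ∀ (R : Type u) [CommRing R] [IsDomain R] [IsDiscreteValuationRing R] [HenselianLocalRing R]
      [IsAdicComplete (IsLocalRing.maximalIdeal R) R],
      IsAlgClosed (IsLocalRing.ResidueField R) →
      ∀ (𝒳 : Over (Spec (.of R))) [Smooth 𝒳.hom] [IsSeparated 𝒳.hom] [QuasiCompact 𝒳.hom],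
        Surjective 𝒳.hom →
        (∀ (x : 𝒳.left) (Ω : 𝒳.left.Opens), x ∈ Ω →
          ∃ a : Spec (.of R) ⟶ 𝒳.left, a ≫ 𝒳.hom = 𝟙 (Spec (.of R)) ∧
            ∃ s : Spec (.of R), a.base s ∈ Ω ∧ 𝒳.hom.base (a.base s) = 𝒳.hom.base x) →
        (∀ s : Spec (.of R), IsPreirreducible (𝒳.hom.base ⁻¹' {s})) →
        ∀ L : BirationalGroupLaw 𝒳, L.IsStrict →
          ∃ (G : Over (Spec (.of R))) (_ : GrpObj G) (j : 𝒳 ⟶ G),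
            Smooth G.hom ∧ IsSeparated G.hom ∧ QuasiCompact G.hom ∧ IsGroupChunkSolution L G j)
    (R' : Type u) [CommRing R'] [IsDomain R'] [IsDiscreteValuationRing R'] [HenselianLocalRing R']
    [IsAdicComplete (IsLocalRing.maximalIdeal R') R'] (hk : IsAlgClosed (IsLocalRing.ResidueField R'))
    (K' : Type u) [Field K'] [Algebra R' K'] [IsFractionRing R' K'] (A' : AbelianVariety K')
    (𝒳' : IntegralModel R' K' A'.X) [GeometricallyIrreducible 𝒳'.total.hom] (hsp : 𝒳'.IsSmoothProper A'.dim) :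
    ∃ _ : GrpObj 𝒳'.total, IsMonHom (M := (genericFibre R' K').obj 𝒳'.total) (N := A'.X) 𝒳'.genericIso.hom := by
  -- the model as an `R′`-scheme
  let 𝒳 : Over (Spec (.of R')) := 𝒳'.total
  haveI : Smooth 𝒳.hom := hsp.1.smooth
  haveI : IsProper 𝒳.hom := hsp.2
  haveI : GeometricallyIrreducible 𝒳.hom := ‹GeometricallyIrreducible 𝒳'.total.hom›
  -- (W0) + A1 + A2: a birational group law `L` on `𝒳`, generically the law of `A′`
  obtain ⟨U, m, hm, hU, hu, hgen, ⟨hΦ, hΦgen⟩, ⟨hΨ, hΨgen⟩⟩ := hW0 R' K' 𝒳 A'.X 𝒳'.genericIso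
  obtain ⟨L, hLgen, hLmul⟩ := exists_birationalGroupLaw_of_shears 𝒳 A'.X 𝒳'.genericIso U m hm hU hu hgen hΦ hΦgen hΨ hΨgen
    (fun h₁ h₂ h₃ h₄ => LawData.assoc_of_genericFibre R' K' 𝒳 A'.X 𝒳'.genericIso U m hm hgen h₁ h₂ h₃ h₄)
  -- GAP-B: the strict open `X₀ ⊇` generic fibre with its strict law `L₀`
  obtain ⟨X₀, L₀, hstrict, hX₀gen, hX₀s, hX₀d, hagree⟩ := strictOpenKeepsGenericFibre R' K' 𝒳 L hLgen
  let 𝒳₀ : Over (Spec (.of R')) := Over.mk (X₀.ι ≫ 𝒳.hom)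
  -- GAP-C: instances of the strict open
  obtain ⟨hsm₀, hsep₀, hqc₀, hsurj₀, hirr₀⟩ := strictOpenInstances 𝒳 X₀ hX₀d
  haveI := hsm₀; haveI := hsep₀; haveI := hqc₀
  -- W1e: dense sections on `X₀`; W1: the group chunk `G ⊇ X₀`
  have hsec : ∀ (x : 𝒳₀.left) (Ω : 𝒳₀.left.Opens), x ∈ Ω →
      ∃ a : Spec (.of R') ⟶ 𝒳₀.left, a ≫ 𝒳₀.hom = 𝟙 (Spec (.of R')) ∧
        ∃ s : Spec (.of R'), a.base s ∈ Ω ∧ 𝒳₀.hom.base (a.base s) = 𝒳₀.hom.base x :=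
    fun x Ω hx => exists_section_apply_mem_fibre R' hk 𝒳₀ hsurj₀ hirr₀ x Ω hx
  obtain ⟨G, instG, j, hGsm, hGsep, hGqc, hsol⟩ := hW1 R' hk 𝒳₀ hsurj₀ hsec hirr₀ L₀ hstrict
  -- GAP-D + (W23): `𝒳 ≅ G` extending `j`
  obtain ⟨hGint, h𝒳int, hGlft, hirrs⟩ := chunkGroupIntegral 𝒳 X₀ L₀ G j hGsm hGsep hGqc hsol
  haveI := hGint; haveI := h𝒳int; haveI := hGlft; haveI := hGsm; haveI := hGsep
  let j₀ : (X₀ : Scheme.{u}) ⟶ G.left := j.left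
  haveI : IsOpenImmersion j₀ := hsol.isOpenImmersion
  have hj₀ : j₀ ≫ G.hom = X₀.ι ≫ 𝒳.hom := Over.w j
  obtain ⟨u, hu, -⟩ := exists_iso_of_isOpenImmersion_of_isIrreducible_specialFibre R' K' 𝒳 hirrs G X₀ hX₀gen hX₀s
    j₀ hj₀
  -- GAP-F: the generic fibre of `G` is `A′` as a group; (W6t-a): transport
  have hmon := genericFibreIsGroupIso R' K' 𝒳 A'.X 𝒳'.genericIso L hLmul X₀ L₀ hX₀gen hagree G j hsol u hu
  let e : (genericFibre R' K').obj G ≅ A'.X := (genericFibre R' K').mapIso u.symm ≪≫ 𝒳'.genericIso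
  have hinst : IsMonHom e.hom := by
    change IsMonHom ((genericFibre R' K').map u.inv ≫ 𝒳'.genericIso.hom)
    exact hmon
  exact @IntegralModel.exists_grpObj_isMonHom_genericIso_of_iso R' K' _ _ _ A' 𝒳' G instG u e hinst
    (by
      change (genericFibre R' K').map u.hom ≫ (genericFibre R' K').map u.inv ≫ 𝒳'.genericIso.hom = _
      rw [← (genericFibre R' K').map_comp_assoc, Iso.hom_inv_id, (genericFibre R' K').map_id, Category.id_comp])

/-- **Koizumi's theorem over a complete strictly local dvr, modulo (W0) and (W1) — (W1) in the v6 TEXT OF RECORD**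
(A-p06 `W1cProbe-v6` :220–:229: `[GeometricallyIrreducible 𝒳.hom]` as an instance binder, no surjectivity / dense-sections /
preirreducibility hypotheses — (W1) derives them inside; B-plan1 14:06:23Z).  This is the form `r0_koizumi` consumes; the v4-binder
`koizumiStrictlyLocal_of` above asks for a STRONGER `hW1` and is kept for the record.  Same statement otherwise: (road W of the `hodgecm-mathlib`
cell; [Koizumi1960] p. 377, [BLRNeronModels1990] 1.2/8 with 4.3–4.4 and 5.1/5, [Artin1986NeronModels] (1.12)): granted the
ω-argument `hW0` (a generically-group-law `R`-birational law on the smooth proper model with open-immersion shears)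
and Weil's group-chunk theorem `hW1` over strictly local bases, every smooth proper integral model
`𝒳′` (geometrically irreducible fibres) of an abelian variety `A′` over a complete dvr `R′` with algebraically closed residue
field carries a group-scheme structure for which its generic identification `𝒳′_{K′} ≅ A′` is a homomorphism.  Proof =
strictification keeping the generic fibre ★ → dense sections ★ → `hW1` → the model IS the group ★ (W23) → the generic fibre of
the group is `A′` as a group ★ (GAP-F) → transport ★ (W6t-a).
[cite: Koizumi1960, Thm. p. 377] [cite: BLRNeronModels1990, §1.2 Prop. 8] [cite: Artin1986NeronModels, Thm. (1.12)] -/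
theorem koizumiStrictlyLocal_of_v6
    (hW0 : ∀ (R : Type u) [CommRing R] [IsDomain R] [IsDiscreteValuationRing R]
      (K : Type u) [Field K] [Algebra R K] [IsFractionRing R K]
      (𝒳 : Over (Spec (.of R))) [Smooth 𝒳.hom] [IsProper 𝒳.hom] [GeometricallyIrreducible 𝒳.hom]
      (E : Over (Spec (.of K))) [GrpObj E] (e : (genericFibre R K).obj 𝒳 ≅ E),
      ∃ (U : (𝒳 ⊗ 𝒳).left.Opens) (m : (U : Scheme.{u}) ⟶ 𝒳.left)
        (hm : m ≫ 𝒳.hom = U.ι ≫ (𝒳 ⊗ 𝒳).hom),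
        (𝒳 ⊗ 𝒳).hom.base ⁻¹' Set.range (specGenericPoint R K).base ⊆ (U : Set (𝒳 ⊗ 𝒳).left) ∧
        (∃ u : (𝒳 ⊗ 𝒳).left, u ∈ U ∧ (𝒳 ⊗ 𝒳).hom.base u = IsLocalRing.closedPoint R) ∧
        (genericFibre R K).map (Over.homMk m hm : Over.mk (U.ι ≫ (𝒳 ⊗ 𝒳).hom) ⟶ 𝒳) ≫ e.hom =
          (genericFibre R K).map (Over.homMk U.ι rfl : Over.mk (U.ι ≫ (𝒳 ⊗ 𝒳).hom) ⟶ 𝒳 ⊗ 𝒳) ≫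
            Functor.OplaxMonoidal.δ (genericFibre R K) 𝒳 𝒳 ≫ (e.hom ⊗ₘ e.hom) ≫ μ[E] ∧
        (let Φ : Over.mk (U.ι ≫ (𝒳 ⊗ 𝒳).hom) ⟶ 𝒳 ⊗ 𝒳 :=
            lift (Over.homMk U.ι rfl ≫ fst 𝒳 𝒳) (Over.homMk m hm);
          IsOpenImmersion Φ.left ∧
            (𝒳 ⊗ 𝒳).hom.base ⁻¹' Set.range (specGenericPoint R K).base ⊆ Set.range Φ.left.base) ∧
        (let Ψ : Over.mk (U.ι ≫ (𝒳 ⊗ 𝒳).hom) ⟶ 𝒳 ⊗ 𝒳 :=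
            lift (Over.homMk m hm) (Over.homMk U.ι rfl ≫ snd 𝒳 𝒳);
          IsOpenImmersion Ψ.left ∧
            (𝒳 ⊗ 𝒳).hom.base ⁻¹' Set.range (specGenericPoint R K).base ⊆ Set.range Ψ.left.base))
    (hW1 : ∀ (R : Type u) [CommRing R] [IsDomain R] [IsDiscreteValuationRing R] [HenselianLocalRing R]
      [IsAdicComplete (IsLocalRing.maximalIdeal R) R],
      IsAlgClosed (IsLocalRing.ResidueField R) →
      ∀ (𝒳 : Over (Spec (.of R))) [Smooth 𝒳.hom] [IsSeparated 𝒳.hom] [QuasiCompact 𝒳.hom]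
        [GeometricallyIrreducible 𝒳.hom],
        ∀ L : BirationalGroupLaw 𝒳, L.IsStrict →
          ∃ (G : Over (Spec (.of R))) (_ : GrpObj G) (j : 𝒳 ⟶ G),
            Smooth G.hom ∧ IsSeparated G.hom ∧ QuasiCompact G.hom ∧ IsGroupChunkSolution L G j)
    (R' : Type u) [CommRing R'] [IsDomain R'] [IsDiscreteValuationRing R'] [HenselianLocalRing R']
    [IsAdicComplete (IsLocalRing.maximalIdeal R') R'] (hk : IsAlgClosed (IsLocalRing.ResidueField R'))
    (K' : Type u) [Field K'] [Algebra R' K'] [IsFractionRing R' K'] (A' : AbelianVariety K')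
    (𝒳' : IntegralModel R' K' A'.X) [GeometricallyIrreducible 𝒳'.total.hom] (hsp : 𝒳'.IsSmoothProper A'.dim) :
    ∃ _ : GrpObj 𝒳'.total, IsMonHom (M := (genericFibre R' K').obj 𝒳'.total) (N := A'.X) 𝒳'.genericIso.hom := by
  -- the model as an `R′`-scheme
  let 𝒳 : Over (Spec (.of R')) := 𝒳'.total
  haveI : Smooth 𝒳.hom := hsp.1.smooth
  haveI : IsProper 𝒳.hom := hsp.2
  haveI : GeometricallyIrreducible 𝒳.hom := ‹GeometricallyIrreducible 𝒳'.total.hom›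
  -- (W0) + A1 + A2: a birational group law `L` on `𝒳`, generically the law of `A′`
  obtain ⟨U, m, hm, hU, hu, hgen, ⟨hΦ, hΦgen⟩, ⟨hΨ, hΨgen⟩⟩ := hW0 R' K' 𝒳 A'.X 𝒳'.genericIso
  obtain ⟨L, hLgen, hLmul⟩ := exists_birationalGroupLaw_of_shears 𝒳 A'.X 𝒳'.genericIso U m hm hU hu hgen hΦ hΦgen hΨ hΨgen
    (fun h₁ h₂ h₃ h₄ => LawData.assoc_of_genericFibre R' K' 𝒳 A'.X 𝒳'.genericIso U m hm hgen h₁ h₂ h₃ h₄)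
  -- GAP-B: the strict open `X₀ ⊇` generic fibre with its strict law `L₀`
  obtain ⟨X₀, L₀, hstrict, hX₀gen, hX₀s, hX₀d, hagree⟩ := strictOpenKeepsGenericFibre R' K' 𝒳 L hLgen
  let 𝒳₀ : Over (Spec (.of R')) := Over.mk (X₀.ι ≫ 𝒳.hom)
  -- GAP-C: instances of the strict open
  obtain ⟨hsm₀, hsep₀, hqc₀, hsurj₀, -⟩ := strictOpenInstances 𝒳 X₀ hX₀d
  haveI := hsm₀; haveI := hsep₀; haveI := hqc₀
  -- W1 (v6 head, A-p06 `W1cProbe-v6` :220): the group chunk `G ⊇ X₀`; `X₀` is geometrically irreducible over `R′` as a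
  -- surjective open of the geometrically irreducible `𝒳` (Mathlib instance; surjectivity = GAP-C)
  haveI : GeometricallyIrreducible 𝒳₀.hom := by
    haveI : Surjective (X₀.ι ≫ 𝒳.hom) := hsurj₀
    change GeometricallyIrreducible (X₀.ι ≫ 𝒳.hom)
    infer_instance
  obtain ⟨G, instG, j, hGsm, hGsep, hGqc, hsol⟩ := hW1 R' hk 𝒳₀ L₀ hstrict
  -- GAP-D + (W23): `𝒳 ≅ G` extending `j`
  obtain ⟨hGint, h𝒳int, hGlft, hirrs⟩ := chunkGroupIntegral 𝒳 X₀ L₀ G j hGsm hGsep hGqc hsol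
  haveI := hGint; haveI := h𝒳int; haveI := hGlft; haveI := hGsm; haveI := hGsep
  let j₀ : (X₀ : Scheme.{u}) ⟶ G.left := j.left
  haveI : IsOpenImmersion j₀ := hsol.isOpenImmersion
  have hj₀ : j₀ ≫ G.hom = X₀.ι ≫ 𝒳.hom := Over.w j
  obtain ⟨u, hu, -⟩ := exists_iso_of_isOpenImmersion_of_isIrreducible_specialFibre R' K' 𝒳 hirrs G X₀ hX₀gen hX₀s
    j₀ hj₀
  -- GAP-F: the generic fibre of `G` is `A′` as a group; (W6t-a): transport
  have hmon := genericFibreIsGroupIso R' K' 𝒳 A'.X 𝒳'.genericIso L hLmul X₀ L₀ hX₀gen hagree G j hsol u hu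
  let e : (genericFibre R' K').obj G ≅ A'.X := (genericFibre R' K').mapIso u.symm ≪≫ 𝒳'.genericIso
  have hinst : IsMonHom e.hom := by
    change IsMonHom ((genericFibre R' K').map u.inv ≫ 𝒳'.genericIso.hom)
    exact hmon
  exact @IntegralModel.exists_grpObj_isMonHom_genericIso_of_iso R' K' _ _ _ A' 𝒳' G instG u e hinst
    (by
      change (genericFibre R' K').map u.hom ≫ (genericFibre R' K').map u.inv ≫ 𝒳'.genericIso.hom = _
      rw [← (genericFibre R' K').map_comp_assoc, Iso.hom_inv_id, (genericFibre R' K').map_id, Category.id_comp])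

end Literature.NumberTheory.DiophantineGeometry

end
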